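import Mathlib.Tactic
import HarnessLib

/-!
# BirchSwinnertonDyer — rank ≥ 2 observatory: the ♯/♭ ↔ (ω, Fω) leading-term dictionary
(instruments U3-SS / U3SS-L8 / U5SS-L5, `SCHNEIDER-CENSUS.md` §3.9 D-b)

HONEST FRAMING: per-curve certified theorems and census instruments; no claim on BSD in rank ≥ 2.

At a supersingular prime `p` with `a = a_p`, the census scorers (`u3ss/ssl1.py`, `u3ss/ssl2.gp`,
`u5ss/sspl1.py`, `u5ss/sspl2.gp`) convert a `D_p`-valued leading term with coordinates
`R = (R_ω, R_{Fω})` (row-vector convention; `M := (1 - φ/p)` acting on coordinate rows is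
`[[1, 1], [-1/p, 1 - a/p]]`, `C := [[a, 1], [-p, 0]]`, `J := diag(1, -1)`) into the pair of
leading coefficients of the Sprung/Pollack series `(L♯, L♭)` by
`(L♯, L♭) = -u · (M²·R)ᵀ · J · C²` (`u` a unit factor carrying `Tam·Ш/#tors²` and `log_p(1+p)^{-r}`).
`SCHNEIDER-CENSUS.md` §3.9 D-b displays the three `p = 3` instances (`a ∈ {0, -3, 3}`) and checks
them cell by cell.  This file proves the underlying identity once for every field element `p ≠ 0`
and every `a`:

  `-(M² R)ᵀ J C² = ((p - (a-1)²)·R_ω + p(2-a)·R_{Fω},  (2-a)·R_ω - (p-1)·R_{Fω})`,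

its specialisations (`p = 3`, `a = 0, -3, 3`, the census lines; `a = 0` for any `p`, in particular
`p = 5`: `(4R_ω + 10R_{Fω}, 2R_ω - 4R_{Fω})`, used by U5SS-L5), and the determinant of the
dictionary `-(p-1)(p-(a-1)²) - p(2-a)²`, which is `-(p+1)²` at `a = 0` and `-1`, `-49` at
`(p, a) = (3, 3), (3, -3)` — in each census case a `p`-adic unit with `p`-integral entries, so the
dictionary preserves `min(v_p)` of the coordinate pair (the fact the D-b event bookkeeping uses).
Only this linear algebra is formalised; nothing about `p`-adic L-functions is.
-/

namespace Summit.BirchSwinnertonDyer.BirchSwinnertonDyer.Rank2Observatory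

open Matrix

variable {K : Type*} [Field K]

/-- `M = 1 - φ/p` on coordinate rows: `[[1, 1], [-1/p, 1 - a/p]]`. -/
def ssM (p a : K) : Matrix (Fin 2) (Fin 2) K := !![1, 1; -1/p, 1 - a/p]

/-- `C = [[a, 1], [-p, 0]]` (the matrix with `C⁻¹ = [[0, -1/p], [1, a/p]]` used by the scorers). -/
def ssC (p a : K) : Matrix (Fin 2) (Fin 2) K := !![a, 1; -p, 0]

/-- `J = diag(1, -1)`. -/
def ssJ : Matrix (Fin 2) (Fin 2) K := !![1, 0; 0, -1]

/-- The dictionary matrix `D(p, a)`: `(L♯, L♭) = u · (R_ω, R_{Fω}) · D`, i.e.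
`L♯ = u((p - (a-1)²)R_ω + p(2-a)R_{Fω})`, `L♭ = u((2-a)R_ω - (p-1)R_{Fω})`. -/
def ssDict (p a : K) : Matrix (Fin 2) (Fin 2) K := !![p - (a - 1)^2, 2 - a; p * (2 - a), -(p - 1)]

/-- `M²`, written out. -/
theorem ssM_sq (p a : K) (hp : p ≠ 0) :
    ssM p a ^ 2 = !![(p - 1)/p, (2*p - a)/p; (a - 2*p)/p^2, ((p - a)^2 - p)/p^2] := by
  rw [sq, ssM, Matrix.mul_fin_two]
  ext i j; fin_cases i <;> fin_cases j <;> simp <;> field_simp <;> ring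

/-- `J·C²`, written out. -/
theorem ssJ_mul_ssC_sq (p a : K) :
    (ssJ : Matrix (Fin 2) (Fin 2) K) * ssC p a ^ 2 = !![a^2 - p, a; p*a, p] := by
  rw [sq, ssJ, ssC, Matrix.mul_fin_two, Matrix.mul_fin_two]
  ext i j; fin_cases i <;> fin_cases j <;> simp; ring

/-- THE DICTIONARY (general `p ≠ 0`, general `a`), as a matrix identity on coordinate rows:
`-(M²)ᵀ · (J C²) = D(p, a)`, equivalently `-(M² R)ᵀ J C² = Rᵀ D` for every column `R`. -/
theorem sharpFlat_dictionary (p a : K) (hp : p ≠ 0) :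
    -((ssM p a ^ 2)ᵀ * ((ssJ : Matrix (Fin 2) (Fin 2) K) * ssC p a ^ 2)) = ssDict p a := by
  rw [ssM_sq p a hp, ssJ_mul_ssC_sq, ssDict]
  ext i j; fin_cases i <;> fin_cases j <;> simp [Matrix.mul_apply, Fin.sum_univ_two] <;> field_simp <;> ring

/-- The same identity applied to a coordinate pair `(x, y) = (R_ω, R_{Fω})`:
the two leading coefficients, entry by entry. -/
theorem sharpFlat_apply (p a x y : K) (hp : p ≠ 0) :
    Matrix.vecMul ![x, y] (-((ssM p a ^ 2)ᵀ * ((ssJ : Matrix (Fin 2) (Fin 2) K) * ssC p a ^ 2)))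
      = ![(p - (a - 1)^2) * x + p * (2 - a) * y, (2 - a) * x - (p - 1) * y] := by
  rw [sharpFlat_dictionary p a hp, ssDict]
  ext i; fin_cases i <;> simp [Matrix.vecMul, dotProduct, Fin.sum_univ_two] <;> ring

/-- Census line `a₃ = 0` (p = 3): `(L♯, L♭) ∝ (2R_ω + 6R_{Fω}, 2R_ω - 2R_{Fω})`. -/
theorem ssDict_three_zero : ssDict (3 : ℚ) 0 = !![2, 2; 6, -2] := by
  rw [ssDict]; ext i j; fin_cases i <;> fin_cases j <;> norm_num

/-- Census line `a₃ = -3` (p = 3): `(L♯, L♭) ∝ (-13R_ω + 15R_{Fω}, 5R_ω - 2R_{Fω})`. -/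
theorem ssDict_three_neg_three : ssDict (3 : ℚ) (-3) = !![-13, 5; 15, -2] := by
  rw [ssDict]; ext i j; fin_cases i <;> fin_cases j <;> norm_num

/-- Census line `a₃ = +3` (p = 3): `(L♯, L♭) ∝ (-R_ω - 3R_{Fω}, -R_ω - 2R_{Fω})`. -/
theorem ssDict_three_three : ssDict (3 : ℚ) 3 = !![-1, -1; -3, -2] := by
  rw [ssDict]; ext i j; fin_cases i <;> fin_cases j <;> norm_num

/-- `a = 0` (the only supersingular value for `p ≥ 5`): `(L♯, L♭) ∝ ((p-1)R_ω + 2pR_{Fω}, 2R_ω - (p-1)R_{Fω})`. -/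
theorem ssDict_zero (p : K) : ssDict p 0 = !![p - 1, 2; 2 * p, -(p - 1)] := by
  rw [ssDict]; ext i j; fin_cases i <;> fin_cases j <;> simp; ring

/-- U5SS-L5 line (p = 5, a = 0): `(L♯, L♭) ∝ (4R_ω + 10R_{Fω}, 2R_ω - 4R_{Fω})`. -/
theorem ssDict_five_zero : ssDict (5 : ℚ) 0 = !![4, 2; 10, -4] := by
  rw [ssDict]; ext i j; fin_cases i <;> fin_cases j <;> norm_num

/-- U7SS-L4 line (p = 7, a = 0): `(L♯, L♭) ∝ (6R_ω + 14R_{Fω}, 2R_ω - 6R_{Fω})`. -/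
theorem ssDict_seven_zero : ssDict (7 : ℚ) 0 = !![6, 2; 14, -6] := by
  rw [ssDict]; ext i j; fin_cases i <;> fin_cases j <;> norm_num

/-- Determinant of the dictionary. -/
theorem det_ssDict (p a : K) : (ssDict p a).det = -(p - 1) * (p - (a - 1)^2) - p * (2 - a)^2 := by
  rw [ssDict, Matrix.det_fin_two_of]; ring

/-- At `a = 0` the determinant is `-(p+1)²` (a `p`-adic unit for every prime `p`). -/
theorem det_ssDict_zero (p : K) : (ssDict p 0).det = -(p + 1)^2 := by
  rw [det_ssDict]; ring

/-- The census determinants at `p = 5` and `p = 7` (`a = 0`): `-36` and `-64`, units at 5 and at 7. -/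
theorem det_ssDict_five_seven :
    (ssDict (5 : ℚ) 0).det = -36 ∧ (ssDict (7 : ℚ) 0).det = -64 := by
  refine ⟨?_, ?_⟩ <;> rw [det_ssDict_zero] <;> norm_num

/-- The three census determinants at `p = 3`: `-16, -49, -1` for `a = 0, -3, 3` — none divisible by 3. -/
theorem det_ssDict_three :
    (ssDict (3 : ℚ) 0).det = -16 ∧ (ssDict (3 : ℚ) (-3)).det = -49 ∧ (ssDict (3 : ℚ) 3).det = -1 := by
  refine ⟨?_, ?_, ?_⟩ <;> rw [det_ssDict] <;> norm_num

end Summit.BirchSwinnertonDyer.BirchSwinnertonDyer.Rank2Observatory
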